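/-
Copyright (c) 2026 the pub-hodgecm-mathlib formalisation cell (harness21).  Prover seat hodgecm-mathlib-K2E3-p37 (g4), Track B «K2-LIT» ∕ hLiu418
#184♮, ROAD Φ, K1-b♮ road (dec-2-pay) F2, brick (H2) F2ε «EVEN-WHITTAKER DECAY ON THE LINE» (K1b desk K2Liu-p14 (g6) WORD #16 (c) ∕ #17 (3),
LEAD F0P6-plan (g16) BATCH #312 (a)).  THEOREMS ONLY (Mathlib-only).
-/
import Summits.HodgeConjecture.HodgeConjecture.Theorems.K2LiuUpperHalfPlaneFourierVanishing   -- ★ `norm_cexp_phase` (the `y → ∞` vanishing twin of §1)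
import Mathlib.Analysis.Complex.CauchyIntegral
import Mathlib.Analysis.SpecialFunctions.ImproperIntegrals
import Mathlib.Analysis.SpecialFunctions.Pow.Deriv
import Mathlib.MeasureTheory.Integral.IntegralEqImproper
import Mathlib.MeasureTheory.Group.Integral
import HarnessLib

/-!
# Crux `HLiu418`, K1-b♮ road, brick (H2) F2ε: THE EVEN LINE WHITTAKER INTEGRALS DECAY LIKE `e^{−π|h|}`

Cell `hodgecm-mathlib`, crux item hLiu418 = `stmt-HodgeConjecture-24832` (helper lane `--supports … --as helper`, count-neutral), route of record
`HCCMUnconditional`; squad K2 ∕ K2Liu.  THEOREMS ONLY (no `def`, no `instance`, no notation, no named-fact hypothesis, no `sorry`); Mathlib-only.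

THE LETTER.  ★ (KW1-d) `K2LiuKindOneLineWhittakerDecay.exists_forall_norm_oddWhittaker_le` bounds the scalar-type line Whittaker integrals of the
odd archimedean types `k = ±(2j+1)` by `C·(1+|h|)·e^{−π|h|}` PLUS the even integrals
`V_m(s,h) = ∫_ℝ (β−i)^{2m}(1+β²)^{−s−m−1}e^{−2πihβ} dβ` (`1 ≤ m ≤ j`) kept BY VALUE («edition 2» of its docstring).  The K1-b♮ presentation's `harch`
letter (★ p865283 :138–:145, line letter `hlin`) needs their `h`-decay for every odd `K_σ`-type.  THIS FILE pays it:
**`exists_forall_norm_evenWhittaker_le (m) (hz₀ : ½ < re z₀) : ∃ C r, 0 ≤ C ∧ 0 < r ∧ ∀ s, dist s z₀ < r → ∀ h, ‖V_m(s,h)‖ ≤ C·(1+|h|)·e^{−π|h|}`**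
(in fact `≤ C·e^{−π|h|}`, `norm_evenWhittaker_le_exp`), by a CONTOUR SHIFT to the horizontal line `im β = ∓½`:
* §1 (generic, Mathlib-only) **`norm_fourier_le_of_differentiable_strip`** — if `F` is complex-differentiable at every point of the closed strip
  `{0 ≤ im z ≤ y}` (`y > 0`) with `‖F z‖ ≤ C∕(1+‖z‖²)` there, then for `h ≤ 0`
  `‖∫_ℝ F(x)e^{−2πihx} dx‖ ≤ C·π·e^{2πhy}` (Cauchy on `[−R,R] × [0,y]`, Mathlib `Complex.integral_boundary_rect_eq_zero_of_differentiableOn`; the vertical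
  sides are `≤ y·C∕(1+R²) → 0`; on the top side `|e^{−2πih(x+iy)}| = e^{2πhy}` and `∫ dx∕(1+x²) = π`); **`…_lowerStrip`** — the mirror statement for `h ≥ 0`
  on `{−y ≤ im z ≤ 0}` (substitution `x ↦ −x`); **`norm_fourier_le_exp_of_differentiable_strip`** — both signs: `‖∫ F e^{−2πih·}‖ ≤ C·π·e^{−2πy|h|}`.
* §2 the instance: `F_s(z) = (z−i)^{2m}(1+z²)^{−s−m−1}` is holomorphic on the strip `|im z| ≤ ½` (`re(1+z²) ≥ ¾ > 0`: principal branch) with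
  `‖F_s(z)‖ ≤ 2^m·5^{re s+m+1}·e^{π|im s|∕2}·(1+‖z‖²)^{−re s−1}` there (`|z−i|² ≤ 2(1+|z|²)`, `|1+z²| ≥ (1+|z|²)∕5`, `|arg(1+z²)| ≤ π∕2`); for
  `0 ≤ re s` this is `≤ K∕(1+‖z‖²)` uniformly for `s` in the ball `dist s z₀ < min(re z₀, 1)`, and §1 at `y = ½` gives the rate `π`.
References: [Bump1997] D. Bump, *Automorphic Forms and Representations* (1997), §1.6, §3.7; [Garrett2018] P. Garrett, *Modern Analysis of Automorphic Forms by
Example* (2018), §1.10.  HONEST LABEL.  Count-neutral helper; closes no socket: `HC_CM` is proved only modulo the 7 printed citations (2 remaining named inputs: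
hLiu418 = `stmt-HodgeConjecture-24832`, h413 = `stmt-HodgeConjecture-24833`) until rung 0 closes.
-/

set_option autoImplicit false
set_option linter.dupNamespace false -- the mandated namespace repeats `HodgeConjecture.HodgeConjecture`

noncomputable section

open Complex MeasureTheory Set Filter intervalIntegral
open scoped Topology

namespace Summit.HodgeConjecture.HodgeConjecture.Cruxes.HLiu418.K2LiuKindOneLineWhittakerDecayEven

open Summit.HodgeConjecture.HodgeConjecture.Cruxes.HLiu418.K2LiuUpperHalfPlaneFourierVanishing (norm_cexp_phase)

/-! ## §1 Generic: Fourier integrals of functions holomorphic on a horizontal strip decay exponentially -/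

section Strip

/-- the bound constant is nonnegative (evaluate at `z = 0`). [folklore] -/
theorem nonneg_of_bound {F : ℂ → ℂ} {C y : ℝ} (hy : 0 ≤ y) (hB : ∀ z : ℂ, 0 ≤ z.im → z.im ≤ y → ‖F z‖ ≤ C / (1 + ‖z‖ ^ 2)) : 0 ≤ C := by
  have h := hB 0 le_rfl (by simpa using hy)
  simp at h
  exact (norm_nonneg _).trans h

/-- on the strip `0 ≤ im z ≤ y` and for `h ≤ 0`: `‖F(z)e^{−2πihz}‖ ≤ C∕(1+‖z‖²)` (`|e^{−2πihz}| = e^{2πh·im z} ≤ 1`). [folklore] -/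
theorem norm_twist_le {F : ℂ → ℂ} {C y : ℝ} (hy : 0 ≤ y) (hB : ∀ z : ℂ, 0 ≤ z.im → z.im ≤ y → ‖F z‖ ≤ C / (1 + ‖z‖ ^ 2))
    {h : ℝ} (hh : h ≤ 0) {z : ℂ} (hz : 0 ≤ z.im) (hzy : z.im ≤ y) :
    ‖F z * Complex.exp (-(2 * Real.pi * I * h * z))‖ ≤ C / (1 + ‖z‖ ^ 2) := by
  rw [norm_mul, norm_cexp_phase]
  have hC : 0 ≤ C / (1 + ‖z‖ ^ 2) := div_nonneg (nonneg_of_bound hy hB) (by positivity)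
  have h2 : Real.exp (2 * Real.pi * h * z.im) ≤ 1 := by
    rw [Real.exp_le_one_iff]
    have : 0 ≤ 2 * Real.pi * (-h) * z.im := mul_nonneg (mul_nonneg (by positivity) (neg_nonneg.2 hh)) hz
    linarith
  calc ‖F z‖ * Real.exp (2 * Real.pi * h * z.im) ≤ C / (1 + ‖z‖ ^ 2) * 1 :=
        mul_le_mul (hB z hz hzy) h2 (Real.exp_pos _).le hC
    _ = C / (1 + ‖z‖ ^ 2) := mul_one _

/-- **VERTICAL SIDES**: `‖∫_0^y F(a+it)e^{−2πih(a+it)} dt‖ ≤ y · C∕(1+a²)` (`h ≤ 0`, `y ≥ 0`). [folklore] -/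
theorem norm_side_le {F : ℂ → ℂ} {C y : ℝ} (hy : 0 ≤ y) (hB : ∀ z : ℂ, 0 ≤ z.im → z.im ≤ y → ‖F z‖ ≤ C / (1 + ‖z‖ ^ 2))
    {h : ℝ} (hh : h ≤ 0) (a : ℝ) :
    ‖∫ t in (0 : ℝ)..y, F (a + t * I) * Complex.exp (-(2 * Real.pi * I * h * (a + t * I)))‖ ≤ C / (1 + a ^ 2) * y := by
  have hC := nonneg_of_bound hy hB
  have h1 := intervalIntegral.norm_integral_le_of_norm_le_const (a := (0 : ℝ)) (b := y) (C := C / (1 + a ^ 2))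
    (f := fun t : ℝ => F (a + t * I) * Complex.exp (-(2 * Real.pi * I * h * (a + t * I)))) (fun t ht => ?_)
  · rwa [sub_zero, abs_of_nonneg hy] at h1
  · rw [Set.uIoc_of_le hy] at ht
    have him : ((a : ℂ) + t * I).im = t := by simp
    refine (norm_twist_le hy hB hh (by rw [him]; exact ht.1.le) (by rw [him]; exact ht.2)).trans ?_
    refine div_le_div_of_nonneg_left hC (by positivity) ?_
    have : a ^ 2 ≤ ‖(a : ℂ) + t * I‖ ^ 2 := by
      rw [Complex.sq_norm, Complex.normSq_apply]
      simp
      nlinarith [sq_nonneg t]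
    linarith

/-- **CONTOUR SHIFT ON A STRIP (upper, `h ≤ 0`)**: if `F` is complex-differentiable at every point of the closed strip `{0 ≤ im z ≤ y}` (`0 < y`) with
`‖F z‖ ≤ C∕(1+‖z‖²)` there, then for every `h ≤ 0`
`∫_ℝ F(x)e^{−2πihx} dx = ∫_ℝ F(x+iy)e^{−2πih(x+iy)} dx` and hence **`‖∫_ℝ F(x)e^{−2πihx} dx‖ ≤ C·π·e^{2πhy}`**.
Cauchy on `[−R,R] × [0,y]` (Mathlib `Complex.integral_boundary_rect_eq_zero_of_differentiableOn`), vertical sides `→ 0` (`norm_side_le`), `R → ∞` on top and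
bottom (`intervalIntegral_tendsto_integral`), `∫ dx∕(1+x²) = π`. [cite: Bump1997, §1.6] -/
theorem norm_fourier_le_of_differentiable_strip {F : ℂ → ℂ} {C y : ℝ} (hy : 0 < y)
    (hF : ∀ z : ℂ, 0 ≤ z.im → z.im ≤ y → DifferentiableAt ℂ F z)
    (hB : ∀ z : ℂ, 0 ≤ z.im → z.im ≤ y → ‖F z‖ ≤ C / (1 + ‖z‖ ^ 2)) {h : ℝ} (hh : h ≤ 0) :
    ‖∫ x : ℝ, F x * Complex.exp (-(2 * Real.pi * I * h * x))‖ ≤ C * Real.pi * Real.exp (2 * Real.pi * h * y) := by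
  have hC := nonneg_of_bound hy.le hB
  obtain ⟨G, hG⟩ : ∃ G : ℂ → ℂ, ∀ z, G z = F z * Complex.exp (-(2 * Real.pi * I * h * z)) := ⟨_, fun z => rfl⟩
  have hGF : (fun x : ℝ => F x * Complex.exp (-(2 * Real.pi * I * h * x))) = fun x : ℝ => G x := funext fun x => (hG x).symm
  rw [hGF]
  have hGd : ∀ z : ℂ, 0 ≤ z.im → z.im ≤ y → DifferentiableAt ℂ G z := by
    intro z hz hzy
    have h1 : DifferentiableAt ℂ (fun z => F z * Complex.exp (-(2 * Real.pi * I * h * z))) z := (hF z hz hzy).mul (by fun_prop)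
    exact h1.congr_of_eventuallyEq (Filter.Eventually.of_forall fun w => hG w)
  -- (1) the rectangle identity `[−R, R] × [0, y]`
  have hrect : ∀ R : ℝ, 0 ≤ R →
      (∫ x in -R..R, G x) = (∫ x in -R..R, G (x + y * I)) - I * (∫ t in (0 : ℝ)..y, G (R + t * I)) + I * (∫ t in (0 : ℝ)..y, G (-R + t * I)) := by
    intro R hR
    have hD : DifferentiableOn ℂ G (Set.uIcc (-(R : ℂ)).re ((R : ℂ) + y * I).re ×ℂ Set.uIcc (-(R : ℂ)).im ((R : ℂ) + y * I).im) := by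
      intro z hz
      have hz2 : z.im ∈ Set.uIcc (-(R : ℂ)).im ((R : ℂ) + y * I).im := hz.2
      have him0 : (-(R : ℂ)).im = 0 := by simp
      have himT : ((R : ℂ) + y * I).im = y := by simp
      rw [him0, himT, Set.uIcc_of_le hy.le] at hz2
      exact (hGd z hz2.1 hz2.2).differentiableWithinAt
    have h0 := Complex.integral_boundary_rect_eq_zero_of_differentiableOn G (-(R : ℂ)) ((R : ℂ) + y * I) hD
    simp only [neg_re, ofReal_re, neg_im, ofReal_im, neg_zero, add_re, mul_re, I_re, mul_zero, I_im, mul_one, sub_self, add_zero,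
      add_im, mul_im, zero_add, ofReal_zero, zero_mul, smul_eq_mul, ofReal_neg] at h0
    linear_combination h0
  -- (2) integrability of the bottom and of the top line
  have hGint : Integrable fun x : ℝ => G x := by
    have hcont : Continuous fun x : ℝ => G x := by
      refine continuous_iff_continuousAt.2 fun x => ?_
      exact ((hGd x (by simp) (by simpa using hy.le)).continuousAt).comp Complex.continuous_ofReal.continuousAt
    refine Integrable.mono' (integrable_inv_one_add_sq.const_mul C) hcont.aestronglyMeasurable (Filter.Eventually.of_forall fun x => ?_)
    have h1 := norm_twist_le hy.le hB hh (z := (x : ℂ)) (by simp) (by simpa using hy.le)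
    rw [Complex.norm_real, Real.norm_eq_abs, sq_abs, div_eq_mul_inv, ← hG] at h1
    exact h1
  have htop_bound : ∀ x : ℝ, ‖G (x + y * I)‖ ≤ C * Real.exp (2 * Real.pi * h * y) * (1 + x ^ 2)⁻¹ := by
    intro x
    have him : ((x : ℂ) + y * I).im = y := by simp
    rw [hG, norm_mul, norm_cexp_phase, him]
    have hFz := hB _ (by rw [him]; exact hy.le) (by rw [him])
    have hn : x ^ 2 ≤ ‖(x : ℂ) + y * I‖ ^ 2 := by
      rw [Complex.sq_norm, Complex.normSq_apply]
      simp
      nlinarith [sq_nonneg y]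
    have hle : C / (1 + ‖(x : ℂ) + y * I‖ ^ 2) ≤ C / (1 + x ^ 2) := div_le_div_of_nonneg_left hC (by positivity) (by linarith)
    calc ‖F (x + y * I)‖ * Real.exp (2 * Real.pi * h * y) ≤ C / (1 + x ^ 2) * Real.exp (2 * Real.pi * h * y) :=
          mul_le_mul_of_nonneg_right (hFz.trans hle) (Real.exp_pos _).le
      _ = C * Real.exp (2 * Real.pi * h * y) * (1 + x ^ 2)⁻¹ := by ring
  have hGtop : Integrable fun x : ℝ => G (x + y * I) := by
    have hcont : Continuous fun x : ℝ => G (x + y * I) := by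
      refine continuous_iff_continuousAt.2 fun x => ?_
      have hline : ContinuousAt (fun x : ℝ => (x : ℂ) + y * I) x := by fun_prop
      exact ContinuousAt.comp (g := G) ((hGd _ (by simp; exact hy.le) (by simp)).continuousAt) hline
    refine Integrable.mono' (integrable_inv_one_add_sq.const_mul (C * Real.exp (2 * Real.pi * h * y))) hcont.aestronglyMeasurable
      (Filter.Eventually.of_forall fun x => ?_)
    exact htop_bound x
  -- (3) `R → ∞`: bottom → `∫ G`, top → `∫ G(· + iy)`, sides → 0
  have hbot : Tendsto (fun R : ℝ => ∫ x in -R..R, G x) atTop (𝓝 (∫ x : ℝ, G x)) :=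
    intervalIntegral_tendsto_integral hGint tendsto_neg_atTop_atBot tendsto_id
  have htop : Tendsto (fun R : ℝ => ∫ x in -R..R, G (x + y * I)) atTop (𝓝 (∫ x : ℝ, G (x + y * I))) :=
    intervalIntegral_tendsto_integral hGtop tendsto_neg_atTop_atBot tendsto_id
  have hside : ∀ ε : ℝ, ε = 1 ∨ ε = -1 → Tendsto (fun R : ℝ => ∫ t in (0 : ℝ)..y, G (ε * R + t * I)) atTop (𝓝 0) := by
    intro ε hε
    rw [tendsto_zero_iff_norm_tendsto_zero]
    have hbound : ∀ R : ℝ, ‖∫ t in (0 : ℝ)..y, G (ε * R + t * I)‖ ≤ C / (1 + R ^ 2) * y := by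
      intro R
      have h1 := norm_side_le hy.le hB hh (ε * R)
      have hε2 : (ε * R) ^ 2 = R ^ 2 := by rcases hε with rfl | rfl <;> ring
      simp only [hG]
      rw [hε2] at h1
      push_cast at h1 ⊢
      exact h1
    have hlim : Tendsto (fun R : ℝ => C / (1 + R ^ 2) * y) atTop (𝓝 0) := by
      have h1 : Tendsto (fun R : ℝ => 1 + R ^ 2) atTop atTop := tendsto_atTop_add_const_left _ _ (tendsto_pow_atTop two_ne_zero)
      have h2 : Tendsto (fun R : ℝ => C / (1 + R ^ 2)) atTop (𝓝 0) := tendsto_const_nhds.div_atTop h1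
      simpa using h2.mul_const y
    exact squeeze_zero_norm' (Filter.Eventually.of_forall fun R => by simpa using hbound R) hlim
  have hR := hside 1 (Or.inl rfl)
  have hL := hside (-1) (Or.inr rfl)
  simp only [one_mul, ofReal_one] at hR
  simp only [neg_mul, one_mul, ofReal_neg, ofReal_one] at hL
  have hlim : Tendsto (fun R : ℝ => ∫ x in -R..R, G x) atTop
      (𝓝 ((∫ x : ℝ, G (x + y * I)) - I * 0 + I * 0)) := by
    refine ((htop.sub (hR.const_mul I)).add (hL.const_mul I)).congr' ?_
    filter_upwards [eventually_ge_atTop (0 : ℝ)] with R hR0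
    rw [hrect R hR0]
  have heq : (∫ x : ℝ, G x) = ∫ x : ℝ, G (x + y * I) := by
    have := tendsto_nhds_unique hbot hlim
    rw [this]
    ring
  -- (4) the bound on the shifted line
  rw [heq]
  refine (MeasureTheory.norm_integral_le_of_norm_le (integrable_inv_one_add_sq.const_mul (C * Real.exp (2 * Real.pi * h * y)))
    (Filter.Eventually.of_forall fun x => htop_bound x)).trans ?_
  rw [MeasureTheory.integral_const_mul, integral_univ_inv_one_add_sq]
  exact le_of_eq (by ring)

/-- **CONTOUR SHIFT ON A STRIP (lower, `0 ≤ h`)**: the mirror statement on `{−y ≤ im z ≤ 0}`: `‖∫_ℝ F(x)e^{−2πihx} dx‖ ≤ C·π·e^{−2πhy}`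
(substitute `x ↦ −x`: `z ↦ F(−z)` lives on the upper strip and `h ↦ −h`). [cite: Bump1997, §1.6] -/
theorem norm_fourier_le_of_differentiable_lowerStrip {F : ℂ → ℂ} {C y : ℝ} (hy : 0 < y)
    (hF : ∀ z : ℂ, -y ≤ z.im → z.im ≤ 0 → DifferentiableAt ℂ F z)
    (hB : ∀ z : ℂ, -y ≤ z.im → z.im ≤ 0 → ‖F z‖ ≤ C / (1 + ‖z‖ ^ 2)) {h : ℝ} (hh : 0 ≤ h) :
    ‖∫ x : ℝ, F x * Complex.exp (-(2 * Real.pi * I * h * x))‖ ≤ C * Real.pi * Real.exp (-(2 * Real.pi * h * y)) := by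
  have hF' : ∀ z : ℂ, 0 ≤ z.im → z.im ≤ y → DifferentiableAt ℂ (fun z => F (-z)) z := by
    intro z hz hzy
    exact (hF (-z) (by simp; linarith) (by simp; exact hz)).comp z differentiableAt_id.neg
  have hB' : ∀ z : ℂ, 0 ≤ z.im → z.im ≤ y → ‖(fun z => F (-z)) z‖ ≤ C / (1 + ‖z‖ ^ 2) := by
    intro z hz hzy
    have h1 := hB (-z) (by simp; linarith) (by simp; exact hz)
    rwa [norm_neg] at h1
  have h1 := norm_fourier_le_of_differentiable_strip hy hF' hB' (h := -h) (neg_nonpos.2 hh)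
  have hsub : (∫ x : ℝ, F x * Complex.exp (-(2 * Real.pi * I * h * x))) =
      ∫ x : ℝ, (fun z => F (-z)) x * Complex.exp (-(2 * Real.pi * I * ((-h : ℝ) : ℂ) * x)) := by
    rw [← integral_neg_eq_self (fun x : ℝ => F x * Complex.exp (-(2 * Real.pi * I * h * x))) volume]
    refine integral_congr_ae (Filter.Eventually.of_forall fun x => ?_)
    simp only [ofReal_neg]
    ring_nf
  rw [hsub]
  refine h1.trans (le_of_eq ?_)
  rw [show 2 * Real.pi * -h * y = -(2 * Real.pi * h * y) by ring]

/-- **BOTH SIGNS**: `F` complex-differentiable on the closed strip `{|im z| ≤ y}` (`0 < y`) with `‖F z‖ ≤ C∕(1+‖z‖²)` there ⇒ for every real `h`,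
`‖∫_ℝ F(x)e^{−2πihx} dx‖ ≤ C·π·e^{−2πy|h|}`. [cite: Bump1997, §1.6] [cite: Garrett2018, §1.10] -/
theorem norm_fourier_le_exp_of_differentiable_strip {F : ℂ → ℂ} {C y : ℝ} (hy : 0 < y)
    (hF : ∀ z : ℂ, |z.im| ≤ y → DifferentiableAt ℂ F z) (hB : ∀ z : ℂ, |z.im| ≤ y → ‖F z‖ ≤ C / (1 + ‖z‖ ^ 2)) (h : ℝ) :
    ‖∫ x : ℝ, F x * Complex.exp (-(2 * Real.pi * I * h * x))‖ ≤ C * Real.pi * Real.exp (-(2 * Real.pi * y * |h|)) := by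
  rcases le_total h 0 with hh | hh
  · have h1 := norm_fourier_le_of_differentiable_strip hy (fun z hz hzy => hF z (abs_le.2 ⟨by linarith, hzy⟩))
      (fun z hz hzy => hB z (abs_le.2 ⟨by linarith, hzy⟩)) hh
    rwa [abs_of_nonpos hh, show -(2 * Real.pi * y * -h) = 2 * Real.pi * h * y by ring]
  · have h1 := norm_fourier_le_of_differentiable_lowerStrip hy (fun z hz hzy => hF z (abs_le.2 ⟨hz, by linarith⟩))
      (fun z hz hzy => hB z (abs_le.2 ⟨hz, by linarith⟩)) hh
    rwa [abs_of_nonneg hh, show -(2 * Real.pi * y * h) = -(2 * Real.pi * h * y) by ring]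

end Strip

/-! ## §2 The even Whittaker integrands on the strip `|im z| ≤ ½` -/

section Even

/-- on the strip `|im z| ≤ ½`: `re(1 + z²) ≥ ¾`, in particular `1 + z² ∈ slitPlane` and `1 + z² ≠ 0`. [folklore] -/
theorem re_one_add_sq_ge {z : ℂ} (hz : |z.im| ≤ 1 / 2) : 3 / 4 ≤ (1 + z ^ 2).re := by
  have h1 : z.im ^ 2 ≤ 1 / 4 := by
    have := abs_le.1 hz
    nlinarith
  simp [sq, Complex.add_re, Complex.mul_re]
  nlinarith [sq_nonneg z.re]

/-- `1 + z² ∈ slitPlane` on the strip. [folklore] -/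
theorem one_add_sq_mem_slitPlane {z : ℂ} (hz : |z.im| ≤ 1 / 2) : 1 + z ^ 2 ∈ slitPlane :=
  Or.inl (by linarith [re_one_add_sq_ge hz])

/-- `|1 + z²| ≥ (1 + |z|²)∕5` on the strip `|im z| ≤ ½` (`|1+z²| ≥ re(1+z²) = 1 + x² − y² ≥ ¾ + x²` and `|z|² ≤ x² + ¼`). [folklore] -/
theorem norm_one_add_sq_ge {z : ℂ} (hz : |z.im| ≤ 1 / 2) : (1 + ‖z‖ ^ 2) / 5 ≤ ‖1 + z ^ 2‖ := by
  have hre := re_one_add_sq_ge hz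
  have h1 : z.im ^ 2 ≤ 1 / 4 := by
    have := abs_le.1 hz
    nlinarith
  have hre' : (1 + z ^ 2).re = 1 + z.re ^ 2 - z.im ^ 2 := by
    simp [sq, Complex.add_re, Complex.mul_re]; ring
  have hn : ‖z‖ ^ 2 = z.re ^ 2 + z.im ^ 2 := by rw [Complex.sq_norm, Complex.normSq_apply]; ring
  calc (1 + ‖z‖ ^ 2) / 5 ≤ (1 + z ^ 2).re := by rw [hn, hre']; nlinarith
    _ ≤ ‖1 + z ^ 2‖ := Complex.re_le_norm _

/-- `|z − i|² ≤ 2·(1 + |z|²)·… ` precisely: `‖z − i‖ ^ 2 ≤ 4 · (1 + ‖z‖²)` hence `‖z − i‖^{2m} ≤ 4^m (1+‖z‖²)^m`. [folklore] -/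
theorem norm_sub_I_pow_le (z : ℂ) (m : ℕ) : ‖z - I‖ ^ (2 * m) ≤ (4 : ℝ) ^ m * (1 + ‖z‖ ^ 2) ^ m := by
  have h1 : ‖z - I‖ ^ 2 ≤ 4 * (1 + ‖z‖ ^ 2) := by
    have h2 : ‖z - I‖ ≤ ‖z‖ + 1 := by
      calc ‖z - I‖ ≤ ‖z‖ + ‖I‖ := norm_sub_le _ _
        _ = ‖z‖ + 1 := by rw [Complex.norm_I]
    have h3 : ‖z - I‖ ^ 2 ≤ (‖z‖ + 1) ^ 2 := pow_le_pow_left₀ (norm_nonneg _) h2 2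
    nlinarith [h3, sq_nonneg (‖z‖ - 1), norm_nonneg z]
  calc ‖z - I‖ ^ (2 * m) = (‖z - I‖ ^ 2) ^ m := by rw [pow_mul]
    _ ≤ (4 * (1 + ‖z‖ ^ 2)) ^ m := pow_le_pow_left₀ (sq_nonneg _) h1 m
    _ = (4 : ℝ) ^ m * (1 + ‖z‖ ^ 2) ^ m := mul_pow _ _ _

/-- **THE EVEN INTEGRAND ON THE STRIP**: for `|im z| ≤ ½`, `0 ≤ re s`,
`‖(z−i)^{2m}(1+z²)^{−s−m−1}‖ ≤ 4^m · 5^{re s + m + 1} · e^{π|im s|∕2} ∕ (1 + ‖z‖²)`. [cite: Bump1997, §1.6] -/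
theorem norm_evenIntegrand_strip_le (m : ℕ) {s : ℂ} (hs : 0 ≤ s.re) {z : ℂ} (hz : |z.im| ≤ 1 / 2) :
    ‖(z - I) ^ (2 * m) * (1 + z ^ 2) ^ (-s - m - 1)‖ ≤
      (4 : ℝ) ^ m * (5 : ℝ) ^ (s.re + m + 1) * Real.exp (Real.pi * |s.im| / 2) / (1 + ‖z‖ ^ 2) := by
  have hw0 : 1 + z ^ 2 ≠ 0 := fun h => by have := re_one_add_sq_ge hz; rw [h] at this; simp at this; linarith
  have hwpos : 0 < ‖1 + z ^ 2‖ := norm_pos_iff.2 hw0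
  have hq : 0 < 1 + ‖z‖ ^ 2 := by positivity
  -- the power of `1 + z²`
  have hre : (-s - (m : ℂ) - 1).re = -(s.re + m + 1) := by simp; ring
  have him : (-s - (m : ℂ) - 1).im = -s.im := by simp
  have harg : |Complex.arg (1 + z ^ 2)| ≤ Real.pi / 2 := abs_arg_le_pi_div_two_iff.2 (by linarith [re_one_add_sq_ge hz])
  have hcpow : ‖(1 + z ^ 2) ^ (-s - (m : ℂ) - 1)‖ ≤ ‖1 + z ^ 2‖ ^ (-(s.re + m + 1)) * Real.exp (Real.pi * |s.im| / 2) := by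
    rw [Complex.norm_cpow_of_ne_zero hw0, hre, him, div_eq_mul_inv, ← Real.exp_neg]
    refine mul_le_mul_of_nonneg_left (Real.exp_le_exp.2 ?_) (Real.rpow_nonneg hwpos.le _)
    have h1 : -(Complex.arg (1 + z ^ 2) * -s.im) = Complex.arg (1 + z ^ 2) * s.im := by ring
    rw [h1]
    calc Complex.arg (1 + z ^ 2) * s.im ≤ |Complex.arg (1 + z ^ 2) * s.im| := le_abs_self _
      _ = |Complex.arg (1 + z ^ 2)| * |s.im| := abs_mul _ _
      _ ≤ Real.pi / 2 * |s.im| := mul_le_mul_of_nonneg_right harg (abs_nonneg _)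
      _ = Real.pi * |s.im| / 2 := by ring
  -- `‖1+z²‖^{−(σ+m+1)} ≤ 5^{σ+m+1} (1+‖z‖²)^{−(σ+m+1)}`
  have hexp : 0 ≤ s.re + m + 1 := by positivity
  have hbase : ‖1 + z ^ 2‖ ^ (-(s.re + m + 1)) ≤ (5 : ℝ) ^ (s.re + m + 1) * (1 + ‖z‖ ^ 2) ^ (-(s.re + m + 1)) := by
    have h5 : (1 + ‖z‖ ^ 2) / 5 ≤ ‖1 + z ^ 2‖ := norm_one_add_sq_ge hz
    have h5pos : 0 < (1 + ‖z‖ ^ 2) / 5 := by positivity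
    calc ‖1 + z ^ 2‖ ^ (-(s.re + m + 1)) ≤ ((1 + ‖z‖ ^ 2) / 5) ^ (-(s.re + m + 1)) :=
          Real.rpow_le_rpow_of_nonpos h5pos h5 (by linarith)
      _ = (5 : ℝ) ^ (s.re + m + 1) * (1 + ‖z‖ ^ 2) ^ (-(s.re + m + 1)) := by
          rw [Real.div_rpow hq.le (by norm_num), Real.rpow_neg (by norm_num : (0:ℝ) ≤ 5), div_eq_mul_inv, inv_inv, mul_comm]
  -- assemble
  rw [norm_mul, norm_pow]
  have hzi := norm_sub_I_pow_le z m
  have hA : 0 ≤ ‖z - I‖ ^ (2 * m) := by positivity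
  have hB : 0 ≤ ‖(1 + z ^ 2) ^ (-s - (m : ℂ) - 1)‖ := norm_nonneg _
  calc ‖z - I‖ ^ (2 * m) * ‖(1 + z ^ 2) ^ (-s - (m : ℂ) - 1)‖
      ≤ ((4 : ℝ) ^ m * (1 + ‖z‖ ^ 2) ^ m) * (((5 : ℝ) ^ (s.re + m + 1) * (1 + ‖z‖ ^ 2) ^ (-(s.re + m + 1))) * Real.exp (Real.pi * |s.im| / 2)) := by
        refine mul_le_mul hzi (hcpow.trans (mul_le_mul_of_nonneg_right hbase (Real.exp_pos _).le)) hB (by positivity)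
    _ = (4 : ℝ) ^ m * (5 : ℝ) ^ (s.re + m + 1) * Real.exp (Real.pi * |s.im| / 2) * ((1 + ‖z‖ ^ 2) ^ (m : ℝ) * (1 + ‖z‖ ^ 2) ^ (-(s.re + m + 1))) := by
        rw [← Real.rpow_natCast (1 + ‖z‖ ^ 2) m]; ring
    _ = (4 : ℝ) ^ m * (5 : ℝ) ^ (s.re + m + 1) * Real.exp (Real.pi * |s.im| / 2) * (1 + ‖z‖ ^ 2) ^ (-(s.re + 1)) := by
        rw [← Real.rpow_add hq]; congr 2; ring
    _ ≤ (4 : ℝ) ^ m * (5 : ℝ) ^ (s.re + m + 1) * Real.exp (Real.pi * |s.im| / 2) * (1 + ‖z‖ ^ 2) ^ (-(1 : ℝ)) := by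
        refine mul_le_mul_of_nonneg_left (Real.rpow_le_rpow_of_exponent_le (by linarith [sq_nonneg ‖z‖]) (by linarith)) (by positivity)
    _ = (4 : ℝ) ^ m * (5 : ℝ) ^ (s.re + m + 1) * Real.exp (Real.pi * |s.im| / 2) / (1 + ‖z‖ ^ 2) := by
        rw [Real.rpow_neg_one]; ring

/-- the even integrand is complex-differentiable on the strip `|im z| ≤ ½` (principal branch of `(1+z²)^{−s−m−1}`, `re(1+z²) > 0`). [folklore] -/
theorem differentiableAt_evenIntegrand (m : ℕ) (s : ℂ) {z : ℂ} (hz : |z.im| ≤ 1 / 2) :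
    DifferentiableAt ℂ (fun z : ℂ => (z - I) ^ (2 * m) * (1 + z ^ 2) ^ (-s - m - 1)) z := by
  refine ((differentiableAt_id.sub_const I).pow _).mul ?_
  exact ((differentiableAt_const (1 : ℂ)).add (differentiableAt_id.pow 2)).cpow (differentiableAt_const _) (one_add_sq_mem_slitPlane hz)

/-- **(H2) F2ε — THE EVEN LINE WHITTAKER INTEGRALS DECAY**: `‖V_m(s,h)‖ ≤ C·e^{−π|h|}` for `s` in the ball `dist s z₀ < min(re z₀, 1)` (`re z₀ > 0`) and ALL
real `h`, `V_m(s,h) = ∫_ℝ (β−i)^{2m}(1+β²)^{−s−m−1}e^{−2πihβ} dβ` — contour shift to `im β = ∓½` (§1 at `y = ½` for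
`F_s(z) = (z−i)^{2m}(1+z²)^{−s−m−1}`, §2's strip bound with `0 ≤ re s ≤ re z₀ + 1`, `|im s| ≤ |im z₀| + 1`). [cite: Bump1997, §1.6, §3.7] [cite: Garrett2018, §1.10] -/
theorem norm_evenWhittaker_le_exp (m : ℕ) {z₀ : ℂ} (hz₀ : 0 < z₀.re) :
    ∃ C r : ℝ, 0 ≤ C ∧ 0 < r ∧ ∀ s : ℂ, dist s z₀ < r → ∀ h : ℝ,
      ‖∫ β : ℝ, ((β : ℂ) - I) ^ (2 * m) * (((1 + β ^ 2 : ℝ)) : ℂ) ^ (-s - m - 1) * Complex.exp (-(2 * Real.pi * I * h * β))‖ ≤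
        C * Real.exp (-(Real.pi * |h|)) := by
  refine ⟨(4 : ℝ) ^ m * (5 : ℝ) ^ (z₀.re + 1 + m + 1) * Real.exp (Real.pi * (|z₀.im| + 1) / 2) * Real.pi, min z₀.re 1, by positivity,
    lt_min hz₀ one_pos, fun s hs h => ?_⟩
  -- `s` in the ball: `0 ≤ re s ≤ re z₀ + 1`, `|im s| ≤ |im z₀| + 1`
  have hsre : |s.re - z₀.re| < min z₀.re 1 := lt_of_le_of_lt (by simpa using abs_re_le_norm (s - z₀)) (by rwa [dist_eq_norm] at hs)
  have hsim : |s.im - z₀.im| < min z₀.re 1 := lt_of_le_of_lt (by simpa using abs_im_le_norm (s - z₀)) (by rwa [dist_eq_norm] at hs)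
  have hs0 : 0 ≤ s.re := by
    have := (abs_lt.1 hsre).1; have := min_le_left z₀.re 1; linarith
  have hs1 : s.re ≤ z₀.re + 1 := by
    have := (abs_lt.1 hsre).2; have := min_le_right z₀.re 1; linarith
  have hsi : |s.im| ≤ |z₀.im| + 1 := by
    have h1 := abs_lt.1 hsim; have := min_le_right z₀.re 1
    have : |s.im| ≤ |z₀.im| + |s.im - z₀.im| := by
      calc |s.im| = |z₀.im + (s.im - z₀.im)| := by ring_nf
        _ ≤ |z₀.im| + |s.im - z₀.im| := abs_add_le _ _
    linarith [abs_lt.2 h1 |>.le]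
  -- the uniform strip constant
  set K : ℝ := (4 : ℝ) ^ m * (5 : ℝ) ^ (s.re + m + 1) * Real.exp (Real.pi * |s.im| / 2) with hK
  have hKle : K ≤ (4 : ℝ) ^ m * (5 : ℝ) ^ (z₀.re + 1 + m + 1) * Real.exp (Real.pi * (|z₀.im| + 1) / 2) := by
    refine mul_le_mul (mul_le_mul_of_nonneg_left (Real.rpow_le_rpow_of_exponent_le (by norm_num) (by linarith)) (by positivity))
      (Real.exp_le_exp.2 (by nlinarith [Real.pi_pos])) (Real.exp_pos _).le (by positivity)
  -- §1 at `y = ½` for `F_s`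
  have hF : ∀ z : ℂ, |z.im| ≤ 1 / 2 → DifferentiableAt ℂ (fun z : ℂ => (z - I) ^ (2 * m) * (1 + z ^ 2) ^ (-s - m - 1)) z :=
    fun z hz => differentiableAt_evenIntegrand m s hz
  have hB : ∀ z : ℂ, |z.im| ≤ 1 / 2 → ‖(fun z : ℂ => (z - I) ^ (2 * m) * (1 + z ^ 2) ^ (-s - m - 1)) z‖ ≤ K / (1 + ‖z‖ ^ 2) :=
    fun z hz => norm_evenIntegrand_strip_le m hs0 hz
  have h1 := norm_fourier_le_exp_of_differentiable_strip (by norm_num : (0 : ℝ) < 1 / 2) hF hB h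
  -- the integrand on the real line IS `F_s`
  have hint : (∫ β : ℝ, ((β : ℂ) - I) ^ (2 * m) * (((1 + β ^ 2 : ℝ)) : ℂ) ^ (-s - m - 1) * Complex.exp (-(2 * Real.pi * I * h * β))) =
      ∫ x : ℝ, (fun z : ℂ => (z - I) ^ (2 * m) * (1 + z ^ 2) ^ (-s - m - 1)) x * Complex.exp (-(2 * Real.pi * I * h * x)) := by
    refine integral_congr_ae (Filter.Eventually.of_forall fun β => ?_)
    simp only [Complex.ofReal_add, Complex.ofReal_one, Complex.ofReal_pow]
  rw [hint]
  refine h1.trans ?_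
  rw [show 2 * Real.pi * (1 / 2) * |h| = Real.pi * |h| by ring]
  exact mul_le_mul_of_nonneg_right (mul_le_mul_of_nonneg_right hKle Real.pi_pos.le) (Real.exp_pos _).le

/-- **(H2) F2ε IN ★ (KW1-d)'s CURRENCY**: near any `z₀` with `re z₀ > ½`, for every `m` and ALL real `h`,
`‖∫_ℝ (β−i)^{2m}(1+β²)^{−s−m−1}e^{−2πihβ} dβ‖ ≤ C·(1+|h|)·e^{−π|h|}` — the shape of ★ `exists_forall_norm_oddWhittaker_le`'s closed-form term, so that its
by-value even terms (`m ↦ m+1`) are paid and the K1-b♮ line letter `hlin` holds for every odd `K_σ`-type. [cite: Bump1997, §1.6, §3.7] -/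
theorem exists_forall_norm_evenWhittaker_le (m : ℕ) {z₀ : ℂ} (hz₀ : 1 / 2 < z₀.re) :
    ∃ C r : ℝ, 0 ≤ C ∧ 0 < r ∧ ∀ s : ℂ, dist s z₀ < r → ∀ h : ℝ,
      ‖∫ β : ℝ, ((β : ℂ) - I) ^ (2 * m) * (((1 + β ^ 2 : ℝ)) : ℂ) ^ (-s - m - 1) * Complex.exp (-(2 * Real.pi * I * h * β))‖ ≤
        C * (1 + |h|) * Real.exp (-(Real.pi * |h|)) := by
  obtain ⟨C, r, hC, hr, hb⟩ := norm_evenWhittaker_le_exp m (by linarith : 0 < z₀.re)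
  refine ⟨C, r, hC, hr, fun s hs h => (hb s hs h).trans ?_⟩
  have h1 : C ≤ C * (1 + |h|) := le_mul_of_one_le_right hC (by linarith [abs_nonneg h])
  exact mul_le_mul_of_nonneg_right h1 (Real.exp_pos _).le

/-- the same at the shifted exponent `−s − (m+1) − 1` with the `ℕ`-cast spelling of ★ (KW1-d) (`((m + 1 : ℕ) : ℂ)`), for direct substitution into
`exists_forall_norm_oddWhittaker_le`'s sum over `m ∈ range j`. [cite: Bump1997, §1.6] -/
theorem exists_forall_norm_evenWhittaker_succ_le (m : ℕ) {z₀ : ℂ} (hz₀ : 1 / 2 < z₀.re) :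
    ∃ C r : ℝ, 0 ≤ C ∧ 0 < r ∧ ∀ s : ℂ, dist s z₀ < r → ∀ h : ℝ,
      ‖∫ β : ℝ, ((β : ℂ) - I) ^ (2 * (m + 1)) * (((1 + β ^ 2 : ℝ)) : ℂ) ^ (-s - ((m + 1 : ℕ) : ℂ) - 1) *
          Complex.exp (-(2 * Real.pi * I * h * β))‖ ≤
        C * (1 + |h|) * Real.exp (-(Real.pi * |h|)) := by
  simpa only [Nat.cast_add, Nat.cast_one] using exists_forall_norm_evenWhittaker_le (m + 1) hz₀

end Even

end Summit.HodgeConjecture.HodgeConjecture.Cruxes.HLiu418.K2LiuKindOneLineWhittakerDecayEven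

end
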